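import Summits.SmoothPoincare4.SmoothPoincare4.Theses.SullivanDual
import Literature.Geometry.Symplectic.TamingWitness
import Literature.Geometry.Symplectic.GromovR4RelEnd
import Literature.Geometry.Symplectic.JConvexMaximumPrinciple
import Literature.Geometry.Kaehler.ManifoldFormsPullback

/-!
# SmoothPoincare4 / SullivanDual — crux `WitnessCharge` (item stmt-SmoothPoincare4-7824), line
`Sketch`: stub `stub_pencilExactTaming` (complete pencil ⇒ exact taming form)

Registered stub of the lead's skeleton (`Cruxes/WitnessCharge/Lines/Sketch.lean`), proved
verbatim. Setting: `Σ` a homotopy `4`-sphere, `p ∈ Σ`, `J` a field of endomorphisms of the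
tangent spaces of `Σ ∖ p`, `0 < ε`; a diffeomorphism `F : ℂ × ℂ ≃ₘ Σ ∖ p` conjugating `J` to a
CONTINUOUS field `Ĵ` on `ℂ × ℂ` (`dF_q (Ĵ_q u) = J_{F q} (dF_q u)`) with holomorphic slices
(`Ĵ_q (0, ζ) = (0, i ζ)`) and positively oriented transverse part (`dA(w, (Ĵ_q (w, 0))₁) > 0`
for `w ≠ 0`; throughout `dA(a, b) = a.re b.im - a.im b.re` is the area form of `ℂ`, written out).
Conclusion: a smooth `1`-form `η` on `Σ ∖ p` with `dη` taming `J` off the punctured `ε`-ball.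

Proof (Gromov 1985, 2.4.A, the taming form of a pencil of `J`-lines, in trivialised form). Put
`G = F⁻¹`, `η = G^* θ_λ` with `θ_λ(q)(u) = Re q₂ Im u₂ + λ Re q₁ Im u₁` the flat primitive of
`Ω_λ = dA_z + λ dA_b` on `ℂ × ℂ` (a continuous LINEAR function of the point, so `η` is smooth and
`dη_x(v, w) = Ω_λ(dG v, dG w)` by naturality of `d`, tree `mextDerivPullback_holds`). By the
conjugation hypothesis and `dF ∘ dG = id`, `dG ∘ dF = id` (chain rule), `dG (J v) = Ĵ_{G x}(dG v)`.
Writing `u = dG v = (w, ζ)` and `Ĵ_q (w, 0) = (P w, C w)`, holomorphicity of the slices gives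
`Ω_λ(u, Ĵ u) = ‖ζ‖² + dA(ζ, C w) + λ dA(w, P w)`. On the compact set `Q = G(K_ε)`,
`K_ε = (Σ ∖ p) ∖ B_ε` (compact as `Σ` is; tree `isCompact_compl_setOf_inPuncturedChartBall`),
continuity of `Ĵ` gives constants `c₀ > 0`, `C₀` with `dA(w, P w) ≥ c₀ ‖w‖²` (minimum on
`Q × unit circle`, homogeneity) and `‖C w‖ ≤ C₀ ‖w‖` (operator norm); choosing `λ = (C₀² + 1) / c₀` AFTER these constants makes
`Ω_λ(u, Ĵ u) ≥ ‖ζ‖² - C₀ ‖ζ‖ ‖w‖ + (C₀² + 1) ‖w‖² > 0` for `u ≠ 0`, and `u = dG v ≠ 0` for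
`v ≠ 0`. The hypotheses `J² = -1` and smoothness of `J` of the registered signature are unused.

## References

* M. Gromov, *Pseudo holomorphic curves in symplectic manifolds*, Invent. Math. 82 (1985),
  §0.2.B, 2.4.A. [Gromov1985]
* F. W. Warner, *Foundations of Differentiable Manifolds and Lie Groups*, GTM 94 (1983),
  2.22–2.23. [WarnerGTM94]
-/

noncomputable section

-- the prescribed namespace `Summit.<P>.<Sub>.…` duplicates `SmoothPoincare4` (P = Sub)
set_option linter.dupNamespace false

open scoped Manifold ContDiff Topology ComplexConjugate
open Set Filter Literature.Geometry.Kaehler Literature.Geometry.Symplectic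
  Literature.Topology.FourManifolds

namespace Summit.SmoothPoincare4.SmoothPoincare4.Theorems.WitnessCharge.PencilIncompleteness

/-! ## The area form of `ℂ` -/

/-- Cauchy–Schwarz for the area form of `ℂ`: `|dA(a, b)| ≤ ‖a‖ ‖b‖`
(`dA(a, b) = Im (ā b)` and `|Im z| ≤ ‖z‖`). [folklore] -/
theorem abs_area_le (a b : ℂ) : |a.re * b.im - a.im * b.re| ≤ ‖a‖ * ‖b‖ := by
  have h : a.re * b.im - a.im * b.re = (conj a * b).im := by
    simp only [Complex.mul_im, Complex.conj_re, Complex.conj_im]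
    ring
  rw [h, ← Complex.norm_conj a, ← norm_mul]
  exact Complex.abs_im_le_norm _

/-- `dA(a, i a) = ‖a‖²`. [folklore] -/
theorem area_self_I_mul (a : ℂ) :
    a.re * (Complex.I * a).im - a.im * (Complex.I * a).re = ‖a‖ ^ 2 := by
  rw [← Complex.normSq_eq_norm_sq, Complex.normSq_apply]
  simp only [Complex.mul_re, Complex.mul_im, Complex.I_re, Complex.I_im]
  ring

/-! ## The pulled-back flat primitive `η = G^* θ_λ` -/

/-- In the flat case a form which is `C^∞` as a plain map is a smooth form (the charts are the
identity, so the chart representative of the form is the form). [folklore] -/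
theorem isSmoothForm_of_contDiff_flat {V : Type*} [NormedAddCommGroup V] [NormedSpace ℝ V]
    {k : ℕ} {f : V → V [⋀^Fin k]→L[ℝ] ℝ} (h : ContDiff ℝ ∞ f) :
    IsSmoothForm (I := 𝓘(ℝ, V)) (M := V) (F := ℝ) (k := k) f := by
  intro x
  have hc : MForm.inChart (I := 𝓘(ℝ, V)) (M := V) (F := ℝ) (k := k) f x = f := by
    funext y
    ext v
    simp [MForm.inChart_apply]
    rfl
  rw [hc]
  exact h.contDiffAt.contDiffWithinAt

section Pullback

variable {E : Type*} [NormedAddCommGroup E] [NormedSpace ℝ E]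
  {H : Type*} [TopologicalSpace H] {I : ModelWithCorners ℝ E H}
  {N : Type*} [TopologicalSpace N] [ChartedSpace H N] [IsManifold I ∞ N]

/-- **The pulled-back flat primitive.** For real `λ` and a `C^∞` map `G : N → ℂ × ℂ` of manifolds
there is a smooth `1`-form `η = G^* θ_λ` on `N` with `dη_x(v, w) = Ω_λ(dG_x v, dG_x w)`,
`Ω_λ(u, u') = dA(u₂, u'₂) + λ dA(u₁, u'₁)`. Here `θ_λ(q)(u) = Re q₂ · Im u₂ + λ · Re q₁ · Im u₁`
on the vector space `ℂ × ℂ` is a continuous LINEAR function of the point (built from `reCLM`,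
`imCLM`, the projections and `ofSubsingleton`), hence a smooth form with
`dθ_λ(u, u') = θ_λ(u)(u') - θ_λ(u')(u) = Ω_λ(u, u')` (Mathlib's `extDeriv`, tree
`extDeriv_apply_pair`); the pull-back of a smooth form is smooth and `d` is natural (Warner (1983),
2.22–2.23; tree `isSmoothFormPullback_holds`, `mextDerivPullback_holds`).
[cite: WarnerGTM94, 2.22–2.23] -/
theorem exists_pullback_theta (lam : ℝ) {G : N → ℂ × ℂ} (hG : ContMDiff I 𝓘(ℝ, ℂ × ℂ) ∞ G) :
    ∃ η : MForm I N ℝ 1, IsSmoothForm η ∧ ∀ (x : N) (v w : TangentSpace I x),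
      mextDeriv η x ![v, w] =
        ((mfderiv I 𝓘(ℝ, ℂ × ℂ) G x v).2.re * (mfderiv I 𝓘(ℝ, ℂ × ℂ) G x w).2.im -
            (mfderiv I 𝓘(ℝ, ℂ × ℂ) G x v).2.im * (mfderiv I 𝓘(ℝ, ℂ × ℂ) G x w).2.re) +
          lam * ((mfderiv I 𝓘(ℝ, ℂ × ℂ) G x v).1.re * (mfderiv I 𝓘(ℝ, ℂ × ℂ) G x w).1.im -
            (mfderiv I 𝓘(ℝ, ℂ × ℂ) G x v).1.im * (mfderiv I 𝓘(ℝ, ℂ × ℂ) G x w).1.re) := by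
  -- the bilinear form `L q u = Re q₂ Im u₂ + λ Re q₁ Im u₁`
  set L : (ℂ × ℂ) →L[ℝ] (ℂ × ℂ) →L[ℝ] ℝ :=
    (ContinuousLinearMap.mul ℝ ℝ).bilinearComp
        (Complex.reCLM.comp (ContinuousLinearMap.snd ℝ ℂ ℂ))
        (Complex.imCLM.comp (ContinuousLinearMap.snd ℝ ℂ ℂ)) +
      lam • (ContinuousLinearMap.mul ℝ ℝ).bilinearComp
        (Complex.reCLM.comp (ContinuousLinearMap.fst ℝ ℂ ℂ))
        (Complex.imCLM.comp (ContinuousLinearMap.fst ℝ ℂ ℂ)) with hL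
  have hLa : ∀ q u : ℂ × ℂ, L q u = q.2.re * u.2.im + lam * (q.1.re * u.1.im) := by
    intro q u
    simp [hL]
  -- `θ_λ` as a continuous linear map from the point to degree-`1` alternating maps
  set T : (ℂ × ℂ) →L[ℝ] ((ℂ × ℂ) [⋀^Fin 1]→L[ℝ] ℝ) :=
    ((ContinuousAlternatingMap.ofSubsingletonLIE (𝕜 := ℝ) (E := ℂ × ℂ) (F := ℝ)
        (0 : Fin 1)).toContinuousLinearEquiv :
        (ℂ × ℂ →L[ℝ] ℝ) →L[ℝ] ((ℂ × ℂ) [⋀^Fin 1]→L[ℝ] ℝ)).comp L with hT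
  have hTa : ∀ (q : ℂ × ℂ) (v : Fin 1 → ℂ × ℂ), T q v = L q (v 0) := by
    intro q v
    simp [hT]
  set θ : MForm 𝓘(ℝ, ℂ × ℂ) (ℂ × ℂ) ℝ 1 := fun q => T q with hθ
  have hθs : IsSmoothForm θ := isSmoothForm_of_contDiff_flat T.contDiff
  have hθd : ∀ q u u' : ℂ × ℂ, mextDeriv θ q ![u, u'] =
      (u.2.re * u'.2.im - u.2.im * u'.2.re) + lam * (u.1.re * u'.1.im - u.1.im * u'.1.re) := by
    intro q u u'
    rw [mextDeriv_eq_extDeriv]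
    change extDeriv (⇑T) q ![u, u'] = _
    rw [extDeriv_apply_pair T.differentiableAt, T.fderiv]
    simp only [hTa, hLa, Matrix.cons_val_zero]
    ring
  refine ⟨θ.pullback I G, isSmoothFormPullback_holds I N 𝓘(ℝ, ℂ × ℂ) (ℂ × ℂ) ℝ hG hθs,
    fun x v w => ?_⟩
  have hvec : (fun i => mfderiv I 𝓘(ℝ, ℂ × ℂ) G x (![v, w] i)) =
      ![mfderiv I 𝓘(ℝ, ℂ × ℂ) G x v, mfderiv I 𝓘(ℝ, ℂ × ℂ) G x w] := by
    funext i
    fin_cases i <;> rfl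
  rw [mextDerivPullback_holds I N 𝓘(ℝ, ℂ × ℂ) (ℂ × ℂ) ℝ hG hθs, MForm.pullback_apply, hvec, hθd]

end Pullback

/-! ## The quadratic estimate and its constants -/

/-- `a² - C a b + (C² + 1) b² > 0` unless `a = b = 0` (`= ¾ a² + (a/2 - C b)² + b²`).
[folklore] -/
theorem quad_pos {a b C : ℝ} (hab : a ≠ 0 ∨ b ≠ 0) :
    0 < a ^ 2 - C * a * b + (C ^ 2 + 1) * b ^ 2 := by
  have hpos : 0 < a ^ 2 + b ^ 2 := by
    rcases hab with h | h
    · exact add_pos_of_pos_of_nonneg (by positivity) (sq_nonneg b)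
    · exact add_pos_of_nonneg_of_pos (sq_nonneg a) (by positivity)
  nlinarith [sq_nonneg (a / 2 - C * b), sq_nonneg a, sq_nonneg b]

/-- **The quadratic estimate.** Let `Ĵ_q` be `ℝ`-linear on `ℂ × ℂ` with holomorphic slice
direction `Ĵ_q (0, ζ) = (0, i ζ)`, transverse part bounded below,
`dA(w, (Ĵ_q(w,0))₁) ≥ c₀ ‖w‖²`, and shear bounded above, `‖(Ĵ_q(w,0))₂‖ ≤ C₀ ‖w‖`. If
`λ ≥ 0` and `λ c₀ = C₀² + 1` then, for every `u = (w, ζ) ≠ 0`,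
`Ω_λ(u, Ĵ_q u) = ‖ζ‖² + dA(ζ, (Ĵ_q(w,0))₂) + λ dA(w, (Ĵ_q(w,0))₁) > 0`.
[cite: Gromov1985, 2.4.A] -/
theorem omega_J_pos {lam c₀ C₀ : ℝ} (hlam0 : 0 ≤ lam)
    (hlam : lam * c₀ = C₀ ^ 2 + 1) (Jq : ℂ × ℂ →L[ℝ] ℂ × ℂ)
    (hslice : ∀ ζ : ℂ, Jq (0, ζ) = (0, Complex.I * ζ))
    (hP : ∀ w : ℂ, c₀ * ‖w‖ ^ 2 ≤ w.re * (Jq (w, 0)).1.im - w.im * (Jq (w, 0)).1.re)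
    (hC : ∀ w : ℂ, ‖(Jq (w, 0)).2‖ ≤ C₀ * ‖w‖) (u : ℂ × ℂ) (hu : u ≠ 0) :
    0 < (u.2.re * (Jq u).2.im - u.2.im * (Jq u).2.re) +
      lam * (u.1.re * (Jq u).1.im - u.1.im * (Jq u).1.re) := by
  obtain ⟨w, ζ⟩ := u
  have hsplit : Jq (w, ζ) = Jq (w, 0) + (0, Complex.I * ζ) := by
    rw [← hslice ζ, ← map_add, Prod.mk_add_mk, add_zero, zero_add]
  simp only [hsplit, Prod.snd_add, Prod.fst_add, add_zero, Complex.add_re, Complex.add_im]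
  -- the three bounds
  have hI := area_self_I_mul ζ
  have h1 : -(‖ζ‖ * (C₀ * ‖w‖)) ≤ ζ.re * (Jq (w, 0)).2.im - ζ.im * (Jq (w, 0)).2.re := by
    have h := (abs_le.1 (abs_area_le ζ (Jq (w, 0)).2)).1
    have h' : ‖ζ‖ * ‖(Jq (w, 0)).2‖ ≤ ‖ζ‖ * (C₀ * ‖w‖) :=
      mul_le_mul_of_nonneg_left (hC w) (norm_nonneg ζ)
    linarith
  have h2 : lam * (c₀ * ‖w‖ ^ 2) ≤
      lam * (w.re * (Jq (w, 0)).1.im - w.im * (Jq (w, 0)).1.re) :=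
    mul_le_mul_of_nonneg_left (hP w) hlam0
  have hab : ‖ζ‖ ≠ 0 ∨ ‖w‖ ≠ 0 := by
    by_contra h
    rw [not_or, not_not, not_not, norm_eq_zero, norm_eq_zero] at h
    exact hu (Prod.ext h.2 h.1)
  have hq := quad_pos (C := C₀) hab
  have h3 : lam * (c₀ * ‖w‖ ^ 2) = (C₀ ^ 2 + 1) * ‖w‖ ^ 2 := by rw [← hlam]; ring
  nlinarith [h1, h2, hq, h3, hI]

/-- **Uniform positivity of the transverse part on a compact set.** For a continuous field `Ĵ`
of `ℝ`-linear endomorphisms of `ℂ × ℂ` whose transverse part is positively oriented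
(`dA(w, (Ĵ_q(w, 0))₁) > 0` for `w ≠ 0`) and a compact set `Q` of points, there is `c₀ > 0` with
`dA(w, (Ĵ_q(w,0))₁) ≥ c₀ ‖w‖²` for all `q ∈ Q` and all `w` (extreme value theorem on
`Q × unit circle`, then homogeneity of degree `2`). [folklore] -/
theorem exists_transverse_lower_bound {Q : Set (ℂ × ℂ)} (hQ : IsCompact Q)
    {Jhat : ℂ × ℂ → (ℂ × ℂ →L[ℝ] ℂ × ℂ)} (hJ : Continuous Jhat)
    (horient : ∀ (q : ℂ × ℂ) (w : ℂ), w ≠ 0 →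
      0 < w.re * ((Jhat q (w, 0)).1).im - w.im * ((Jhat q (w, 0)).1).re) :
    ∃ c₀ : ℝ, 0 < c₀ ∧ ∀ q ∈ Q, ∀ w : ℂ,
      c₀ * ‖w‖ ^ 2 ≤ w.re * ((Jhat q (w, 0)).1).im - w.im * ((Jhat q (w, 0)).1).re := by
  set f : (ℂ × ℂ) × ℂ → ℝ :=
    fun x => x.2.re * ((Jhat x.1 (x.2, 0)).1).im - x.2.im * ((Jhat x.1 (x.2, 0)).1).re with hf
  have hfc : Continuous f := by
    have h1 : Continuous fun x : (ℂ × ℂ) × ℂ => Jhat x.1 (x.2, 0) :=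
      (hJ.comp continuous_fst).clm_apply (continuous_snd.prodMk continuous_const)
    simp only [hf]
    fun_prop
  have hS : IsCompact (Q ×ˢ Metric.sphere (0 : ℂ) 1) := hQ.prod (isCompact_sphere 0 1)
  have hpos : ∀ x ∈ Q ×ˢ Metric.sphere (0 : ℂ) 1, (0 : ℝ) < f x := by
    rintro ⟨q, w⟩ ⟨-, hw⟩
    have hw0 : w ≠ 0 := by
      rintro rfl
      simp at hw
    exact horient q w hw0
  obtain ⟨c₀, hc₀, hle⟩ := hS.exists_forall_le' hfc.continuousOn hpos
  refine ⟨c₀, hc₀, fun q hq w => ?_⟩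
  rcases eq_or_ne w 0 with rfl | hw
  · simp
  have hn : 0 < ‖w‖ := norm_pos_iff.2 hw
  -- `w = ‖w‖ • w₁` with `w₁` on the unit circle; homogeneity of degree `2`
  set w₁ : ℂ := (‖w‖⁻¹ : ℝ) • w with hw₁
  have hw₁s : w₁ ∈ Metric.sphere (0 : ℂ) 1 := by
    rw [mem_sphere_zero_iff_norm, hw₁, norm_smul, norm_inv, norm_norm, inv_mul_cancel₀ hn.ne']
  have hww : w = (‖w‖ : ℝ) • w₁ := by
    rw [hw₁, smul_smul, mul_inv_cancel₀ hn.ne', one_smul]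
  have hle' : c₀ ≤ f (q, w₁) := hle (q, w₁) ⟨hq, hw₁s⟩
  have hJw : Jhat q (w, 0) = (‖w‖ : ℝ) • Jhat q (w₁, 0) := by
    rw [← map_smul, Prod.smul_mk, smul_zero, ← hww]
  have hre : w.re = ‖w‖ * w₁.re := by
    conv_lhs => rw [hww]
    rw [Complex.smul_re, smul_eq_mul]
  have him : w.im = ‖w‖ * w₁.im := by
    conv_lhs => rw [hww]
    rw [Complex.smul_im, smul_eq_mul]
  have hhom : w.re * ((Jhat q (w, 0)).1).im - w.im * ((Jhat q (w, 0)).1).re =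
      ‖w‖ ^ 2 * f (q, w₁) := by
    rw [hJw, Prod.smul_fst, Complex.smul_re, Complex.smul_im, hre, him]
    simp only [hf, smul_eq_mul]
    ring
  rw [hhom, mul_comm]
  exact mul_le_mul_of_nonneg_left hle' (sq_nonneg _)

/-- **Uniform bound of the shear part on a compact set**: for continuous `Ĵ` and compact `Q`
there is `C₀` with `‖(Ĵ_q(w, 0))₂‖ ≤ C₀ ‖w‖` for `q ∈ Q` (operator norm bounded on `Q`).
[folklore] -/
theorem exists_shear_upper_bound {Q : Set (ℂ × ℂ)} (hQ : IsCompact Q)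
    {Jhat : ℂ × ℂ → (ℂ × ℂ →L[ℝ] ℂ × ℂ)} (hJ : Continuous Jhat) :
    ∃ C₀ : ℝ, ∀ q ∈ Q, ∀ w : ℂ, ‖(Jhat q (w, 0)).2‖ ≤ C₀ * ‖w‖ := by
  obtain ⟨C, hC⟩ := hQ.exists_bound_of_continuousOn hJ.continuousOn
  refine ⟨max C 0, fun q hq w => ?_⟩
  calc ‖(Jhat q (w, 0)).2‖ ≤ ‖Jhat q (w, 0)‖ := norm_snd_le _
    _ ≤ ‖Jhat q‖ * ‖((w, 0) : ℂ × ℂ)‖ := (Jhat q).le_opNorm _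
    _ = ‖Jhat q‖ * ‖w‖ := by simp
    _ ≤ max C 0 * ‖w‖ :=
      mul_le_mul_of_nonneg_right ((hC q hq).trans (le_max_left _ _)) (norm_nonneg _)

/-! ## Differentials of a diffeomorphism and of its inverse -/

section Diffeo

variable {E : Type*} [NormedAddCommGroup E] [NormedSpace ℝ E]
  {H : Type*} [TopologicalSpace H] {I : ModelWithCorners ℝ E H}
  {M : Type*} [TopologicalSpace M] [ChartedSpace H M]
  {E' : Type*} [NormedAddCommGroup E'] [NormedSpace ℝ E']
  {H' : Type*} [TopologicalSpace H'] {I' : ModelWithCorners ℝ E' H'}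
  {N : Type*} [TopologicalSpace N] [ChartedSpace H' N]

/-- `dF_{F⁻¹ x} ∘ d(F⁻¹)_x = id` for a diffeomorphism `F` (chain rule for `F ∘ F⁻¹ = id`).
[folklore] -/
theorem mfderiv_apply_mfderiv_symm (F : M ≃ₘ⟮I, I'⟯ N) (x : N) (v : TangentSpace I' x) :
    mfderiv I I' F (F.symm x) (mfderiv I' I F.symm x v) = v := by
  have hF : MDifferentiableAt I I' F (F.symm x) := F.contMDiff.mdifferentiableAt (by simp)
  have hG : MDifferentiableAt I' I F.symm x := F.symm.contMDiff.mdifferentiableAt (by simp)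
  have h := mfderiv_comp x hF hG
  have hid : ((F : M → N) ∘ (F.symm : N → M)) = id := funext F.apply_symm_apply
  rw [hid, mfderiv_id] at h
  exact (ContinuousLinearMap.ext_iff.1 h v).symm

/-- `d(F⁻¹)_x ∘ dF_{F⁻¹ x} = id` for a diffeomorphism `F` (chain rule for `F⁻¹ ∘ F = id` at
`F⁻¹ x`, base point `F (F⁻¹ x) = x`). [folklore] -/
theorem mfderiv_symm_apply_mfderiv (F : M ≃ₘ⟮I, I'⟯ N) (x : N)
    (u : TangentSpace I (F.symm x)) :
    mfderiv I' I F.symm x (mfderiv I I' F (F.symm x) u) = u := by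
  have hF : MDifferentiableAt I I' F (F.symm x) := F.contMDiff.mdifferentiableAt (by simp)
  have hG : MDifferentiableAt I' I F.symm (F (F.symm x)) :=
    F.symm.contMDiff.mdifferentiableAt (by simp)
  have h := mfderiv_comp (F.symm x) hG hF
  have hid : ((F.symm : N → M) ∘ (F : M → N)) = id := funext F.symm_apply_apply
  rw [hid, mfderiv_id] at h
  have h2 := (ContinuousLinearMap.ext_iff.1 h u).symm
  simp only [ContinuousLinearMap.coe_id', id_eq] at h2
  rw [F.apply_symm_apply] at h2
  exact h2

end Diffeo

/-! ## The registered stub -/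

/-- **COMPLETE PENCIL ⇒ EXACT TAMING FORM.** If `Σ ∖ p` is globally parametrised by a
diffeomorphism `F : ℂ × ℂ ≃ₘ Σ∖p` conjugating `J` to a CONTINUOUS structure `Ĵ` on `ℂ × ℂ`
(`dF ∘ Ĵ = J ∘ dF`) whose slices `{b} × ℂ` are holomorphic (`Ĵ (0, ζ) = (0, i ζ)`) and whose
transverse part is positively oriented (`dA(w, (Ĵ (w, 0)).1) > 0`), then for `0 < ε` the exact form
`d(F_* θ_λ)`, `θ_λ` a primitive of `dA_z + λ dA_b`, `λ ≫ 1`, is smooth and tames `J` off the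
punctured `ε`-ball (compactness of `K_ε = Σ ∖ (B_ε ∪ p)`: `Ω_λ(u, Ĵu) = λ dA(w, J'w) + |ζ|² +
dA(ζ, C w) > 0` once `λ c₀ > C₀² / 4`). [cite: Gromov1985, 2.4.A] -/
theorem stub_pencilExactTaming :
    ∀ (S : HomotopySphere 4) (p : S.carrier)
      (J : ∀ x : punctured p, TangentSpace (𝓡 4) x →L[ℝ] TangentSpace (𝓡 4) x) (ε : ℝ),
      0 < ε →
      (∀ (x : punctured p) (v : TangentSpace (𝓡 4) x), J x (J x v) = -v) →
      (∀ x₀ : punctured p, ContMDiffAt (𝓡 4) 𝓘(ℝ, EuclideanSpace ℝ (Fin 4) →L[ℝ] EuclideanSpace ℝ (Fin 4)) ∞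
        (inTangentCoordinates (𝓡 4) (𝓡 4) (id : punctured p → punctured p) id (fun x => J x) x₀) x₀) →
      ∀ (F : (ℂ × ℂ) ≃ₘ⟮𝓘(ℝ, ℂ × ℂ), 𝓡 4⟯ (punctured p))
        (Jhat : ℂ × ℂ → (ℂ × ℂ →L[ℝ] ℂ × ℂ)), Continuous Jhat →
      (∀ (q : ℂ × ℂ) (u : ℂ × ℂ),
        mfderiv 𝓘(ℝ, ℂ × ℂ) (𝓡 4) F q (Jhat q u) = J (F q) (mfderiv 𝓘(ℝ, ℂ × ℂ) (𝓡 4) F q u)) →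
      (∀ (q : ℂ × ℂ) (ζ : ℂ), Jhat q (0, ζ) = (0, Complex.I * ζ)) →
      (∀ (q : ℂ × ℂ) (w : ℂ), w ≠ 0 →
        0 < w.re * ((Jhat q (w, 0)).1).im - w.im * ((Jhat q (w, 0)).1).re) →
      ∃ η : MForm (𝓡 4) (punctured p) ℝ 1, IsSmoothForm η ∧ TamesOffBall p ε J (mextDeriv η) := by
  intro S p J ε hε _hJsq _hJsmooth F Jhat hJc hconj hslice horient
  -- the inverse diffeomorphism `G = F⁻¹ : Σ ∖ p → ℂ × ℂ`
  have hGs : ContMDiff (𝓡 4) 𝓘(ℝ, ℂ × ℂ) ∞ F.symm := F.symm.contMDiff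
  -- the compact piece `K_ε` (tree), its image `Q = G(K_ε)`; the constants `c₀`, `C₀`, then `λ`
  have hQ : IsCompact (F.symm '' {x : punctured p | InPuncturedChartBall p ε x}ᶜ) :=
    (gromov_recognitionR4_relEnd.isCompact_compl_setOf_inPuncturedChartBall p hε).image
      F.symm.continuous
  obtain ⟨c₀, hc₀, hP⟩ := exists_transverse_lower_bound hQ hJc horient
  obtain ⟨C₀, hC⟩ := exists_shear_upper_bound hQ hJc
  set lam : ℝ := (C₀ ^ 2 + 1) / c₀
  have hlam : lam * c₀ = C₀ ^ 2 + 1 := div_mul_cancel₀ _ hc₀.ne'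
  have hlam0 : 0 ≤ lam := div_nonneg (by positivity) hc₀.le
  -- the form `η = G^* θ_λ`: smooth, `dη_x(v, w) = Ω_λ(dG v, dG w)`
  obtain ⟨η, hηs, hηd⟩ := exists_pullback_theta (I := 𝓡 4) lam hGs
  refine ⟨η, hηs, fun x hx v hv => ?_⟩
  rw [hηd x v (J x v)]
  -- `dG (J v) = Ĵ_{G x} (dG v)`
  have hkey : mfderiv (𝓡 4) 𝓘(ℝ, ℂ × ℂ) F.symm x (J x v) =
      Jhat (F.symm x) (mfderiv (𝓡 4) 𝓘(ℝ, ℂ × ℂ) F.symm x v) := by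
    have h1 := hconj (F.symm x) (mfderiv (𝓡 4) 𝓘(ℝ, ℂ × ℂ) F.symm x v)
    rw [mfderiv_apply_mfderiv_symm F x v] at h1
    rw [F.apply_symm_apply] at h1
    rw [← h1]
    exact mfderiv_symm_apply_mfderiv F x _
  rw [hkey]
  -- `u = dG v ≠ 0`
  have hu : mfderiv (𝓡 4) 𝓘(ℝ, ℂ × ℂ) F.symm x v ≠ 0 := by
    intro hu
    apply hv
    have h := congrArg (mfderiv 𝓘(ℝ, ℂ × ℂ) (𝓡 4) F (F.symm x)) hu
    rw [mfderiv_apply_mfderiv_symm, map_zero] at h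
    exact h
  exact omega_J_pos hlam0 hlam (Jhat (F.symm x)) (hslice (F.symm x)) (hP _ ⟨x, hx, rfl⟩)
    (hC _ ⟨x, hx, rfl⟩) _ hu

end Summit.SmoothPoincare4.SmoothPoincare4.Theorems.WitnessCharge.PencilIncompleteness
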